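import Mathlib
import Literature.NumberTheory.Transcendental.ZagierDilogarithmConjecture
import Literature.NumberTheory.Transcendental.PreBlochGroup
import Literature.NumberTheory.Transcendental.PreBlochPlaces
import Summits.KontsevichZagierPeriods.KontsevichZagierPeriods.Theorems.HyperbolicBlochZagierDilogarithmConjectureStubTwoSaturation
import Summits.KontsevichZagierPeriods.KontsevichZagierPeriods.Theorems.HyperbolicBlochZagierDilogarithmConjectureStubDistributionSlice
import Summits.KontsevichZagierPeriods.KontsevichZagierPeriods.Theorems.HyperbolicBlochZagierDilogarithmConjectureGaussCertificate
import HarnessLib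

/-!
# `ZagierDilogarithmConjecture` (stmt-KontsevichZagierPeriods-10550) — line `kummer-clausen-linearisation`
# (c5 cycle 3, "certificate #3"), stub `stub_gaussianMembership` — THE GAUSSIAN CIRCLE RELATION IS EXPLAINED UNCONDITIONALLY

`6[i] − 2[(4+3i)/5] − 3[(3+4i)/5] − [(−3+4i)/5] ∈ ⟨dilogRelators⟩` — with no hypothesis. Its value shadow is the circle
relation `2 D((4+3i)/5) + 3 D((3+4i)/5) + D((−3+4i)/5) = 6 D(i) = 6G` (`G` = Catalan's constant; all four points unimodular, so
these are Clausen values `Cl₂(θ)` at `cos θ ∈ {0, 4/5, 3/5, −3/5}`) — one of the "Bloch-group relations" found numerically by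
the crux disprover's circle sweep (kit j012999/j013275: wedge exactly `0`, `r₂(ℚ(i)) = 1`, hence explained by Borel + Suslin);
here it is a THEOREM outright: Zagier's conjecture holds for this relation with no appeal to Borel's or Suslin's theorems.

Proof. Specialise the certificate identity `gauss_cert_identity'` (file `…GaussCertificate`: 3 five-term relations in `𝒫(F)`)
to `F = ℚ̄ = algebraicClosure ℚ ℂ`, `Z = i`; lift the extended symbols to `ℤ⟨ℚ̄ ∖ {0,1}⟩` (`distrib_exists_symLift`), so
the lifted combination lies in the five-term span of `ℚ̄`, which `closure_fiveTerm_le_comap` maps into `⟨dilogRelators⟩ ⊂ ℤ[ℂ]`;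
the conjugation pairs are the relators `[w] + [w̄]`, the fixed symbols are real points. Certificate: `{1+i, 2±i}`-unit search over
`ℚ(i)` + exact sparse linear algebra (lead c5 cycle 3, scripts `scratch/gauss/search.py`, `solve.py`, `gen.py`, `gen2.py`).
Sorry-free; axioms ⊆ {propext, Classical.choice, Quot.sound}.
-/

noncomputable section

open scoped BigOperators ComplexConjugate
open Literature.NumberTheory.Transcendental

namespace Summit.KontsevichZagierPeriods.HyperbolicBloch.ZagierDilogarithmCertificate

/-- **The Gaussian circle relation is explained UNCONDITIONALLY** (stub `stub_gaussianMembership`, line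
`kummer-clausen-linearisation`, c5 cycle 3): `6[i] − 2[(4+3i)/5] − 3[(3+4i)/5] − [(−3+4i)/5] ∈ ⟨dilogRelators⟩`, by the formal
certificate `gauss_cert_identity` in `𝒫(ℚ̄)` pushed forward to `ℤ[ℂ]`: the five-term span of `ℚ̄` maps into `⟨dilogRelators⟩`,
the conjugation pairs and the real symbols ARE relators. Value shadow: `2D((4+3i)/5) + 3D((3+4i)/5) + D((−3+4i)/5) = 6G`.
No Borel, no numerics. [cite: Neumann1998, §2.1 end (pp. 393–394)] -/
theorem stub_gaussianMembership :
    ((6 : ℤ) • FreeAbelianGroup.of Complex.I - (2 : ℤ) • FreeAbelianGroup.of ((4 + 3 * Complex.I) / 5) -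
          (3 : ℤ) • FreeAbelianGroup.of ((3 + 4 * Complex.I) / 5) -
          FreeAbelianGroup.of ((-3 + 4 * Complex.I) / 5)) ∈
        AddSubgroup.closure dilogRelators := by
  classical
  have hΦ : Complex.I ^ 2 + 1 = 0 := by rw [Complex.I_sq]; ring
  have hconj : (starRingEnd ℂ) Complex.I = Complex.I ^ 7 := by
    have e : Complex.I ^ 7 = (Complex.I ^ 2) ^ 3 * Complex.I := by ring
    rw [e, Complex.I_sq, Complex.conj_I]; ring
  set Q : IntermediateField ℚ ℂ := algebraicClosure ℚ ℂ with hQdef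
  haveI : IsAlgClosure ℚ Q := algebraicClosure.isAlgClosure ℚ ℂ
  haveI : IsAlgClosed Q := IsAlgClosure.isAlgClosed ℚ
  have hQ : ∀ z, z ∈ Q ↔ IsAlgebraic ℚ z := fun _ => mem_algebraicClosure_iff
  have hζalg : IsAlgebraic ℚ Complex.I := by
    refine ⟨Polynomial.X ^ 2 + 1, ?_, ?_⟩
    · intro h0
      have h1 := congrArg (Polynomial.eval 0) h0
      simp at h1
    · simp
  let Z : Q := ⟨Complex.I, (hQ _).2 hζalg⟩
  have hZ : algebraMap Q ℂ Z = Complex.I := rfl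
  have hΦQ : Z ^ 2 + 1 = 0 := by
    apply Subtype.ext
    rw [show ∀ q : Q, (q : ℂ) = algebraMap Q ℂ q from fun q => rfl]
    simp only [map_add, map_pow, map_one, hZ]
    exact hΦ
  -- the points of the certificate, as elements of Q (fvars, with their complex values)
  obtain ⟨P1, hP1, cP1⟩ : ∃ P : Q, P = ((1 : Q) * Z) ∧ (P : ℂ) = ((1 : ℂ) * Complex.I) :=
    ⟨_, rfl, by rw [gauss_coe1 Q Z, hZ]⟩
  obtain ⟨P2, hP2, cP2⟩ : ∃ P : Q, P = ((4 / 5 : Q) + (3 / 5 : Q) * Z) ∧ (P : ℂ) = ((4 / 5 : ℂ) + (3 / 5 : ℂ) * Complex.I) :=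
    ⟨_, rfl, by rw [gauss_coe2 Q Z, hZ]⟩
  obtain ⟨P3, hP3, cP3⟩ : ∃ P : Q, P = ((3 / 5 : Q) + (4 / 5 : Q) * Z) ∧ (P : ℂ) = ((3 / 5 : ℂ) + (4 / 5 : ℂ) * Complex.I) :=
    ⟨_, rfl, by rw [gauss_coe3 Q Z, hZ]⟩
  obtain ⟨P4, hP4, cP4⟩ : ∃ P : Q, P = ((-3 / 5 : Q) + (4 / 5 : Q) * Z) ∧ (P : ℂ) = ((-3 / 5 : ℂ) + (4 / 5 : ℂ) * Complex.I) :=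
    ⟨_, rfl, by rw [gauss_coe4 Q Z, hZ]⟩
  obtain ⟨P5, hP5, cP5⟩ : ∃ P : Q, P = ((-1 / 2 : Q) * Z) ∧ (P : ℂ) = ((-1 / 2 : ℂ) * Complex.I) :=
    ⟨_, rfl, by rw [gauss_coe5 Q Z, hZ]⟩
  obtain ⟨P6, hP6, cP6⟩ : ∃ P : Q, P = ((1 / 2 : Q) * Z) ∧ (P : ℂ) = ((1 / 2 : ℂ) * Complex.I) :=
    ⟨_, rfl, by rw [gauss_coe6 Q Z, hZ]⟩
  obtain ⟨P7, hP7, cP7⟩ : ∃ P : Q, P = ((-1 : Q) + (-1 : Q) * Z) ∧ (P : ℂ) = ((-1 : ℂ) + (-1 : ℂ) * Complex.I) :=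
    ⟨_, rfl, by rw [gauss_coe7 Q Z, hZ]⟩
  obtain ⟨P8, hP8, cP8⟩ : ∃ P : Q, P = ((-1 : Q) + (1 : Q) * Z) ∧ (P : ℂ) = ((-1 : ℂ) + (1 : ℂ) * Complex.I) :=
    ⟨_, rfl, by rw [gauss_coe8 Q Z, hZ]⟩
  obtain ⟨P9, hP9, cP9⟩ : ∃ P : Q, P = ((-1 : Q)) ∧ (P : ℂ) = ((-1 : ℂ)) :=
    ⟨_, rfl, by rw [gauss_coe9 Q]⟩
  -- the certificate identity in 𝒫(Q), in terms of the points
  have ID := gauss_cert_identity' Z hΦQ P1 P2 P3 P4 P5 P6 P7 P8 P9 hP1 hP2 hP3 hP4 hP5 hP6 hP7 hP8 hP9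
  -- lift the extended symbols to the free abelian group on Q ∖ {0,1}
  obtain ⟨s, hs1, hs2⟩ := Summit.KontsevichZagierPeriods.HyperbolicBloch.ZagierDilogarithmGaloisDescent.distrib_exists_symLift (Q := Q)
  obtain ⟨E, hEdef⟩ : ∃ E : FreeAbelianGroup (PreBloch.Gen Q), E = (6 : ℤ) • s P1 + (-2 : ℤ) • s P2 + (-3 : ℤ) • s P3 + (-1 : ℤ) • s P4 + (1 : ℤ) • (s P5 + s P6) + (2 : ℤ) • (s P7 + s P8) + (-1 : ℤ) • s P9 := ⟨_, rfl⟩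
  have hE : PreBloch.proj E = 0 := by
    rw [hEdef]
    simp only [map_add, map_zsmul, Summit.KontsevichZagierPeriods.HyperbolicBloch.ZagierDilogarithmGaloisDescent.distrib_proj_symLift hs1 hs2]
    exact ID
  have hEmem : E ∈ AddSubgroup.closure (fiveTermRelators Q) := (PreBloch.proj_eq_zero_iff E).1 hE
  -- push forward to ℤ[ℂ]
  let ι : FreeAbelianGroup (PreBloch.Gen Q) →+ FreeAbelianGroup ℂ :=
    FreeAbelianGroup.lift fun g => FreeAbelianGroup.of (g.val : ℂ)
  have hι : ∀ g, ι (FreeAbelianGroup.of g) = FreeAbelianGroup.of (g.val : ℂ) := fun g => FreeAbelianGroup.lift_apply_of _ _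
  have hιE : ι E ∈ AddSubgroup.closure dilogRelators :=
    Summit.KontsevichZagierPeriods.HyperbolicBloch.ZagierDilogarithm.closure_fiveTerm_le_comap (fun z hz => (hQ z).1 hz) ι hι hEmem
  have hC : ((6 : ℤ) • FreeAbelianGroup.of ((P1 : Q) : ℂ) + (-2 : ℤ) • FreeAbelianGroup.of ((P2 : Q) : ℂ) + (-3 : ℤ) • FreeAbelianGroup.of ((P3 : Q) : ℂ) + (-1 : ℤ) • FreeAbelianGroup.of ((P4 : Q) : ℂ) + (1 : ℤ) • (FreeAbelianGroup.of ((P5 : Q) : ℂ) + FreeAbelianGroup.of ((P6 : Q) : ℂ)) + (2 : ℤ) • (FreeAbelianGroup.of ((P7 : Q) : ℂ) + FreeAbelianGroup.of ((P8 : Q) : ℂ)) + (-1 : ℤ) • FreeAbelianGroup.of ((P9 : Q) : ℂ)) - ι E =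
      (6 : ℤ) • (FreeAbelianGroup.of ((P1 : Q) : ℂ) - ι (s P1)) + (-2 : ℤ) • (FreeAbelianGroup.of ((P2 : Q) : ℂ) - ι (s P2)) + (-3 : ℤ) • (FreeAbelianGroup.of ((P3 : Q) : ℂ) - ι (s P3)) + (-1 : ℤ) • (FreeAbelianGroup.of ((P4 : Q) : ℂ) - ι (s P4)) + (1 : ℤ) • ((FreeAbelianGroup.of ((P5 : Q) : ℂ) - ι (s P5)) + (FreeAbelianGroup.of ((P6 : Q) : ℂ) - ι (s P6))) + (2 : ℤ) • ((FreeAbelianGroup.of ((P7 : Q) : ℂ) - ι (s P7)) + (FreeAbelianGroup.of ((P8 : Q) : ℂ) - ι (s P8))) + (-1 : ℤ) • (FreeAbelianGroup.of ((P9 : Q) : ℂ) - ι (s P9)) := by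
    rw [hEdef]
    simp only [map_add, map_zsmul]
    abel
  have hCmem : ((6 : ℤ) • FreeAbelianGroup.of ((P1 : Q) : ℂ) + (-2 : ℤ) • FreeAbelianGroup.of ((P2 : Q) : ℂ) + (-3 : ℤ) • FreeAbelianGroup.of ((P3 : Q) : ℂ) + (-1 : ℤ) • FreeAbelianGroup.of ((P4 : Q) : ℂ) + (1 : ℤ) • (FreeAbelianGroup.of ((P5 : Q) : ℂ) + FreeAbelianGroup.of ((P6 : Q) : ℂ)) + (2 : ℤ) • (FreeAbelianGroup.of ((P7 : Q) : ℂ) + FreeAbelianGroup.of ((P8 : Q) : ℂ)) + (-1 : ℤ) • FreeAbelianGroup.of ((P9 : Q) : ℂ)) ∈ AddSubgroup.closure dilogRelators := by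
    have h1 : ((6 : ℤ) • FreeAbelianGroup.of ((P1 : Q) : ℂ) + (-2 : ℤ) • FreeAbelianGroup.of ((P2 : Q) : ℂ) + (-3 : ℤ) • FreeAbelianGroup.of ((P3 : Q) : ℂ) + (-1 : ℤ) • FreeAbelianGroup.of ((P4 : Q) : ℂ) + (1 : ℤ) • (FreeAbelianGroup.of ((P5 : Q) : ℂ) + FreeAbelianGroup.of ((P6 : Q) : ℂ)) + (2 : ℤ) • (FreeAbelianGroup.of ((P7 : Q) : ℂ) + FreeAbelianGroup.of ((P8 : Q) : ℂ)) + (-1 : ℤ) • FreeAbelianGroup.of ((P9 : Q) : ℂ)) - ι E ∈ AddSubgroup.closure dilogRelators := by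
      rw [hC]
      exact (add_mem (add_mem (add_mem (add_mem (add_mem (add_mem (AddSubgroup.zsmul_mem _ (Summit.KontsevichZagierPeriods.HyperbolicBloch.ZagierDilogarithmGaloisDescent.distrib_iota_symLift_sub_mem hs1 hs2 ι hι _) _) (AddSubgroup.zsmul_mem _ (Summit.KontsevichZagierPeriods.HyperbolicBloch.ZagierDilogarithmGaloisDescent.distrib_iota_symLift_sub_mem hs1 hs2 ι hι _) _)) (AddSubgroup.zsmul_mem _ (Summit.KontsevichZagierPeriods.HyperbolicBloch.ZagierDilogarithmGaloisDescent.distrib_iota_symLift_sub_mem hs1 hs2 ι hι _) _)) (AddSubgroup.zsmul_mem _ (Summit.KontsevichZagierPeriods.HyperbolicBloch.ZagierDilogarithmGaloisDescent.distrib_iota_symLift_sub_mem hs1 hs2 ι hι _) _)) (AddSubgroup.zsmul_mem _ (add_mem (Summit.KontsevichZagierPeriods.HyperbolicBloch.ZagierDilogarithmGaloisDescent.distrib_iota_symLift_sub_mem hs1 hs2 ι hι _) (Summit.KontsevichZagierPeriods.HyperbolicBloch.ZagierDilogarithmGaloisDescent.distrib_iota_symLift_sub_mem hs1 hs2 ι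 hι _)) _)) (AddSubgroup.zsmul_mem _ (add_mem (Summit.KontsevichZagierPeriods.HyperbolicBloch.ZagierDilogarithmGaloisDescent.distrib_iota_symLift_sub_mem hs1 hs2 ι hι _) (Summit.KontsevichZagierPeriods.HyperbolicBloch.ZagierDilogarithmGaloisDescent.distrib_iota_symLift_sub_mem hs1 hs2 ι hι _)) _)) (AddSubgroup.zsmul_mem _ (Summit.KontsevichZagierPeriods.HyperbolicBloch.ZagierDilogarithmGaloisDescent.distrib_iota_symLift_sub_mem hs1 hs2 ι hι _) _))
    have h2 := add_mem h1 hιE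
    rwa [sub_add_cancel] at h2
  have pair1 : FreeAbelianGroup.of ((P5 : Q) : ℂ) + FreeAbelianGroup.of ((P6 : Q) : ℂ) ∈ AddSubgroup.closure dilogRelators := by
    have h := of_add_of_conj_mem_dilogRelators ((hQ _).1 (P5 : Q).2)
    have e : conj ((P5 : Q) : ℂ) = ((P6 : Q) : ℂ) := by
      rw [cP5, cP6]; exact (gauss_conjpair1 Complex.I hΦ hconj).symm
    rw [e] at h
    exact AddSubgroup.subset_closure h
  have pair2 : FreeAbelianGroup.of ((P7 : Q) : ℂ) + FreeAbelianGroup.of ((P8 : Q) : ℂ) ∈ AddSubgroup.closure dilogRelators := by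
    have h := of_add_of_conj_mem_dilogRelators ((hQ _).1 (P7 : Q).2)
    have e : conj ((P7 : Q) : ℂ) = ((P8 : Q) : ℂ) := by
      rw [cP7, cP8]; exact (gauss_conjpair2 Complex.I hΦ hconj).symm
    rw [e] at h
    exact AddSubgroup.subset_closure h
  have real1 : FreeAbelianGroup.of ((P9 : Q) : ℂ) ∈ AddSubgroup.closure dilogRelators := by
    have him : ((P9 : Q) : ℂ).im = 0 := by rw [cP9]; exact gauss_real1
    exact AddSubgroup.subset_closure (of_real_mem_dilogRelators him)
  have tg1 : ((P1 : Q) : ℂ) = Complex.I := by rw [cP1]; ring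
  have tg2 : ((P2 : Q) : ℂ) = ((4 + 3 * Complex.I) / 5) := by rw [cP2]; ring
  have tg3 : ((P3 : Q) : ℂ) = ((3 + 4 * Complex.I) / 5) := by rw [cP3]; ring
  have tg4 : ((P4 : Q) : ℂ) = ((-3 + 4 * Complex.I) / 5) := by rw [cP4]; ring
  have key : (6 : ℤ) • FreeAbelianGroup.of Complex.I - (2 : ℤ) • FreeAbelianGroup.of ((4 + 3 * Complex.I) / 5) -
        (3 : ℤ) • FreeAbelianGroup.of ((3 + 4 * Complex.I) / 5) -
        FreeAbelianGroup.of ((-3 + 4 * Complex.I) / 5) =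
      ((6 : ℤ) • FreeAbelianGroup.of ((P1 : Q) : ℂ) + (-2 : ℤ) • FreeAbelianGroup.of ((P2 : Q) : ℂ) + (-3 : ℤ) • FreeAbelianGroup.of ((P3 : Q) : ℂ) + (-1 : ℤ) • FreeAbelianGroup.of ((P4 : Q) : ℂ) + (1 : ℤ) • (FreeAbelianGroup.of ((P5 : Q) : ℂ) + FreeAbelianGroup.of ((P6 : Q) : ℂ)) + (2 : ℤ) • (FreeAbelianGroup.of ((P7 : Q) : ℂ) + FreeAbelianGroup.of ((P8 : Q) : ℂ)) + (-1 : ℤ) • FreeAbelianGroup.of ((P9 : Q) : ℂ)) - ((1 : ℤ) • (FreeAbelianGroup.of ((P5 : Q) : ℂ) + FreeAbelianGroup.of ((P6 : Q) : ℂ)) + (2 : ℤ) • (FreeAbelianGroup.of ((P7 : Q) : ℂ) + FreeAbelianGroup.of ((P8 : Q) : ℂ))) - ((-1 : ℤ) • FreeAbelianGroup.of ((P9 : Q) : ℂ)) := by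
    rw [tg1, tg2, tg3, tg4]
    abel
  rw [key]
  exact sub_mem (sub_mem hCmem (add_mem (AddSubgroup.zsmul_mem _ pair1 _) (AddSubgroup.zsmul_mem _ pair2 _))) (AddSubgroup.zsmul_mem _ real1 _)

end Summit.KontsevichZagierPeriods.HyperbolicBloch.ZagierDilogarithmCertificate

end
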